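import Summits.Parity.GeneralizedHardyLittlewood.Theorems.RomanoffHeathBrownClassEnergyTools
import Literature.NumberTheory.Sieve.BombieriAsymptoticSieveMertens

/-!
# Route `RomanoffHeathBrown` — crux `LargeModuliCorrelation` (stmt-Parity-20273), PROVED

`theorem romanoffHeathBrown_largeModuliCorrelation_proof : LargeModuliCorrelation`: for every `c > 0`
and `ε > 0` there is `N₀` with
`∑_{√(ηX) < d ≤ N, d odd squarefree} g(d) ∑_{r<d} U_d(r)² ≤ ε · η²N · U` for `N ≥ N₀`
(`u = hbWeight c N`, `U = ∑_{k≤N} u(k)`, `U_d(r) = ∑_{k≤N, k≡r (d)} u(k)`, `g(d) = ∏_{p∣d} 1/(p−2)`,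
`X = (N/6)^{1/3}`, `η = (log X)^{−c}`, `S = ⌊X(1+η)⌋ − ⌊X⌋`).

Proof (the route's BC3 skeleton): (A) `classSum_le_lattice` — for every square-free `d` and every
`r`, `U_d(r) ≤ N^{1/3} log N · S · 3^{ω(d)} (S/d + 1)` (one `y` at a time the `x` with
`x³ ≡ r − 2y³ (mod d)` lie in `≤ 3^{ω(d)}` classes: tree `card_pairBox_modEq_le_of_prod_primes`);
(B) `largeModuli_sum_le` — with `g(d) ≤ 3^{ω(d)}/d` the `d`-sum is
`≤ N^{1/3} log N · S (S ∑_{d > √(ηX)} 18^{ω}/d² + ∑_{d ≤ N} 9^{ω}/d)`, the Rankin tail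
(`exists_tail_sum_eighteen_div_sq_le`) is `≪ (ηX)^{−1/4}` and the full sum is
`≤ ∏_{p≤N}(1 + 1/p)^9 ≪ (log N)^9` (`BombieriSieve.prod_primesGe_one_add_inv_le`), so the total is
`≪ η²N (log X (ηX)^{−1/4} + (log X)^{10}/(ηX)) = o(η²N)` because `ηX ≥ √X`
(`log x = o(x^{1/8})`, `(log x)^{10} = o(x^{1/2})`); (C) `∑_r U_d(r)² ≤ sup_r U_d(r) · U` (`classEnergy_le`).

References: Halberstam–Richert, *Sieve Methods* Ch. 2 §2 [HalberstamRichert1974]; Montgomery–Vaughan,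
*Multiplicative Number Theory I* §7.1 [MontgomeryVaughan2007]; Heath-Brown–Moroz, Proc. LMS 88 (2004)
Lemma 2.4 [HeathBrownMoroz2004].
-/

noncomputable section

open Finset Filter Topology Asymptotics
open Literature.NumberTheory.Sieve Literature.NumberTheory.Sieve.CubicPrimes
open Literature.NumberTheory.Sieve.CubicMinorant
open Summit.Parity.GeneralizedHardyLittlewood.Theses.RomanoffHeathBrown

namespace Summit.Parity.GeneralizedHardyLittlewood.Theorems.RomanoffHeathBrown

/-! ### (A) the lattice count for every square-free modulus -/

/-- **(A) the lattice count**: for square-free `d`, every `r`, and `S = hbSide c N ≥ 1`,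
`U_d(r) ≤ N^{1/3} log N · S · 3^{ω(d)} · (S/d + 1)`.
[cite: HeathBrownMoroz2004, Lemma 2.4 (i) with §3 (3.1)–(3.3)] -/
theorem classSum_le_lattice (c : ℝ) (N : ℕ) (hS : 1 ≤ hbSide c N) {d : ℕ} (hsq : Squarefree d)
    (r : ℕ) :
    ∑ k ∈ (Icc 1 N).filter (fun k : ℕ => k ≡ r [MOD d]), hbWeight c N k ≤
      (N : ℝ) ^ ((1 : ℝ) / 3) * Real.log N *
        ((hbSide c N : ℝ) * 3 ^ #d.primeFactors * ((hbSide c N : ℝ) / d + 1)) := by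
  refine (sum_hbWeight_modEq_le_card c N d r).trans ?_
  refine mul_le_mul_of_nonneg_left ?_ (mul_nonneg (by positivity) (Real.log_natCast_nonneg N))
  have hsub := primePairs_subset_box c N hS
  have h1 : #{xy ∈ primePairs (hbX N) (hbEta c N) | xy.1 ^ 3 + 2 * xy.2 ^ 3 ≡ r [MOD d]} ≤
      #{xy ∈ Ioc ⌊hbX N⌋₊ (⌊hbX N⌋₊ + hbSide c N) ×ˢ Ioc ⌊hbX N⌋₊ (⌊hbX N⌋₊ + hbSide c N) |
        xy.1 ^ 3 + 2 * xy.2 ^ 3 ≡ r [MOD d]} :=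
    card_le_card (filter_subset_filter _ hsub)
  have h2 := card_pairBox_modEq_le_of_prod_primes (t := d.primeFactors)
    (fun p hp => Nat.prime_of_mem_primeFactors hp) ⌊hbX N⌋₊ ⌊hbX N⌋₊ (hbSide c N) r
  rw [Nat.prod_primeFactors_of_squarefree hsq] at h2
  exact (Nat.cast_le.mpr h1).trans h2

/-! ### (B) the `d`-sum beyond `√(ηX)` -/

/-- `g(d) · S 3^{ω(d)} (S/d + 1) ≤ S (S ∏_{p∣d} 9/p² + ∏_{p∣d} 9/p)` for odd square-free `d`
(`g(d) ≤ 3^{ω(d)}/d`). [this line] -/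
theorem singWeight_mul_lattice_le {d : ℕ} (hsq : Squarefree d) (hodd : Odd d) (hd : 0 < d)
    {S : ℝ} (hS : 0 ≤ S) :
    (∏ p ∈ d.primeFactors, (1 : ℝ) / ((p : ℝ) - 2)) *
        (S * 3 ^ #d.primeFactors * (S / d + 1)) ≤
      S * (S * ∏ p ∈ d.primeFactors, (9 : ℝ) / (p : ℝ) ^ 2 +
        ∏ p ∈ d.primeFactors, (9 : ℝ) / (p : ℝ)) := by
  have hg := singWeight_le hsq hodd
  have hdR : (0 : ℝ) < d := by exact_mod_cast hd
  have e1 : (9 : ℝ) ^ #d.primeFactors / d = ∏ p ∈ d.primeFactors, (9 : ℝ) / (p : ℝ) := by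
    simpa only [pow_one] using pow_card_div_pow_eq_prod hsq 9 1
  rw [← pow_card_div_pow_eq_prod hsq 9 2, ← e1]
  have h9 : (9 : ℝ) ^ #d.primeFactors = 3 ^ #d.primeFactors * 3 ^ #d.primeFactors := by
    rw [← mul_pow]; norm_num
  calc (∏ p ∈ d.primeFactors, (1 : ℝ) / ((p : ℝ) - 2)) * (S * 3 ^ #d.primeFactors * (S / d + 1))
      ≤ ((3 : ℝ) ^ #d.primeFactors / d) * (S * 3 ^ #d.primeFactors * (S / d + 1)) :=
        mul_le_mul_of_nonneg_right hg (by positivity)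
    _ = S * (S * ((9 : ℝ) ^ #d.primeFactors / (d : ℝ) ^ 2) + 9 ^ #d.primeFactors / d) := by
        rw [h9]; field_simp

/-- `∑_{d ≤ N squarefree} ∏_{p∣d} 9/p ≤ ∏_{p ≤ N}(1 + 1/p)^9 ≤ (e⁵ log N/log 2)^9` (`N ≥ 2`).
[cite: MontgomeryVaughan2007, §7.1 (sums over square-free numbers against Euler products)] -/
theorem sum_prod_nine_div_le {N : ℕ} (hN : 2 ≤ N) (G : Finset ℕ)
    (hG : ∀ d ∈ G, Squarefree d ∧ d ∈ Icc 1 N) :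
    ∑ d ∈ G, ∏ p ∈ d.primeFactors, (9 : ℝ) / (p : ℝ) ≤
      (Real.exp 5 * Real.log N / Real.log 2) ^ 9 := by
  classical
  set P := (Nat.primesLE ⌊(N : ℝ)⌋₊).filter (fun p : ℕ => (2 : ℝ) ≤ (p : ℝ)) with hP
  have hGP : ∀ d ∈ G, Squarefree d ∧ d.primeFactors ⊆ P := by
    intro d hd
    obtain ⟨hsq, hdI⟩ := hG d hd
    refine ⟨hsq, fun p hp => ?_⟩
    have hpp := Nat.prime_of_mem_primeFactors hp
    rw [hP, BombieriSieve.mem_primesGe, Nat.floor_natCast]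
    exact ⟨hpp, by exact_mod_cast hpp.two_le,
      (Nat.le_of_mem_primeFactors hp).trans (mem_Icc.mp hdI).2⟩
  have h9 : ∀ p ∈ P, 1 + (9 : ℝ) / p ≤ (1 + (p : ℝ)⁻¹) ^ 9 := by
    intro p _
    have hp0 : (0 : ℝ) ≤ (p : ℝ)⁻¹ := by positivity
    have hb := one_add_mul_le_pow (by linarith : (-2 : ℝ) ≤ (p : ℝ)⁻¹) 9
    have e : (9 : ℝ) / p = 9 * (p : ℝ)⁻¹ := div_eq_mul_inv _ _
    rw [e]
    exact_mod_cast hb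
  calc ∑ d ∈ G, ∏ p ∈ d.primeFactors, (9 : ℝ) / (p : ℝ)
      ≤ ∏ p ∈ P, (1 + (9 : ℝ) / p) :=
        PintzRuzsa2003.sum_prod_primeFactors_le_prod_one_add _ (fun p _ => by positivity) hGP
    _ ≤ ∏ p ∈ P, (1 + (p : ℝ)⁻¹) ^ 9 := prod_le_prod (fun p _ => by positivity) h9
    _ = (∏ p ∈ P, (1 + (p : ℝ)⁻¹)) ^ 9 := prod_pow P 9 _
    _ ≤ (Real.exp 5 * Real.log N / Real.log 2) ^ 9 :=
        pow_le_pow_left₀ (prod_nonneg fun p _ => by positivity)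
          (BombieriSieve.prod_primesGe_one_add_inv_le le_rfl (by exact_mod_cast hN)) 9

/-- The arithmetic of step (B): `A ℓN · S (S C/u + K ℓN⁹) ≤ ε η² (6X³)` from `A ≤ 2X`, `ℓN ≤ 4ℓX`,
`S ≤ 2ηX`, `32 C ℓX ≤ 3εu` and `4¹¹ K ℓX¹⁰ ≤ 3ε ηX`. [this line] -/
theorem largeTail_arith {A ℓN ℓX S η X u C K ε : ℝ} (hX : 0 < X) (hA : A ≤ 2 * X)
    (hℓN0 : 0 ≤ ℓN) (hℓN : ℓN ≤ 4 * ℓX) (hS0 : 0 ≤ S) (hS : S ≤ 2 * (η * X)) (hη : 0 ≤ η)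
    (hu : 0 < u) (hC : 0 ≤ C) (hK : 0 ≤ K)
    (h1 : 32 * C * ℓX ≤ 3 * ε * u) (h2 : 4 ^ 11 * K * ℓX ^ 10 ≤ 3 * ε * (η * X)) :
    A * ℓN * (S * (S * (C / u) + K * ℓN ^ 9)) ≤ ε * (η ^ 2 * (6 * X ^ 3)) := by
  have hℓX0 : 0 ≤ ℓX := by linarith
  have hηX : 0 ≤ η * X := by positivity
  have t1 : A * ℓN * (S * (S * (C / u))) ≤ 3 * ε * (η ^ 2 * X ^ 3) := by
    calc A * ℓN * (S * (S * (C / u))) = A * ℓN * S ^ 2 * C / u := by ring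
      _ ≤ (2 * X) * (4 * ℓX) * (2 * (η * X)) ^ 2 * C / u := by gcongr
      _ = (32 * C * ℓX) * (η ^ 2 * X ^ 3) / u := by ring
      _ ≤ (3 * ε * u) * (η ^ 2 * X ^ 3) / u := by gcongr
      _ = 3 * ε * (η ^ 2 * X ^ 3) := by rw [div_eq_iff hu.ne']; ring
  have t2 : A * ℓN * (S * (K * ℓN ^ 9)) ≤ 3 * ε * (η ^ 2 * X ^ 3) := by
    calc A * ℓN * (S * (K * ℓN ^ 9)) = A * S * K * ℓN ^ 10 := by ring
      _ ≤ (2 * X) * (2 * (η * X)) * K * (4 * ℓX) ^ 10 := by gcongr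
      _ = (4 ^ 11 * K * ℓX ^ 10) * (η * X ^ 2) := by ring
      _ ≤ (3 * ε * (η * X)) * (η * X ^ 2) := by gcongr
      _ = 3 * ε * (η ^ 2 * X ^ 3) := by ring
  calc A * ℓN * (S * (S * (C / u) + K * ℓN ^ 9))
      = A * ℓN * (S * (S * (C / u))) + A * ℓN * (S * (K * ℓN ^ 9)) := by ring
    _ ≤ 3 * ε * (η ^ 2 * X ^ 3) + 3 * ε * (η ^ 2 * X ^ 3) := add_le_add t1 t2
    _ = ε * (η ^ 2 * (6 * X ^ 3)) := by ring

/-- **(B) the large-moduli tail is `o(η²N)`**: for `c > 0` and `ε > 0`, for all large `N` (also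
`S ≥ 1`), `N^{1/3} log N · ∑_{√(ηX) < d ≤ N, d odd sqf} g(d) · S 3^{ω(d)} (S/d + 1) ≤ ε η² N`.
[cite: HalberstamRichert1974, Ch. 2 §2 (2.3)–(2.4) (Rankin's trick for sums over square-free d)] -/
theorem largeModuli_sum_le {c : ℝ} (hc : 0 < c) {ε : ℝ} (hε : 0 < ε) :
    ∃ N₀ : ℕ, ∀ N : ℕ, N₀ ≤ N → 1 ≤ hbSide c N ∧
      (N : ℝ) ^ ((1 : ℝ) / 3) * Real.log N *
          ∑ d ∈ (Icc 1 N).filter (fun d : ℕ =>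
              Squarefree d ∧ Odd d ∧ Real.sqrt (hbEta c N * hbX N) < d),
            (∏ p ∈ d.primeFactors, (1 : ℝ) / ((p : ℝ) - 2)) *
              ((hbSide c N : ℝ) * 3 ^ #d.primeFactors * ((hbSide c N : ℝ) / d + 1)) ≤
        ε * (hbEta c N ^ 2 * N) := by
  classical
  obtain ⟨C, hC, htail⟩ := exists_tail_sum_eighteen_div_sq_le
  have hlog2 : 0 < Real.log 2 := Real.log_pos one_lt_two
  set K : ℝ := (Real.exp 5 / Real.log 2) ^ 9 with hK
  have hK0 : 0 ≤ K := by positivity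
  set δ₁ : ℝ := 3 * ε / (32 * C) with hδ₁
  set δ₂ : ℝ := 3 * ε / (4 ^ 11 * (K + 1)) with hδ₂
  have hδ₁0 : 0 < δ₁ := by positivity
  have hδ₂0 : 0 < δ₂ := by positivity
  -- the two growth facts in the real variable, pulled back along `X = hbX N → ∞`
  have hL1 : ∀ᶠ x : ℝ in atTop, Real.log x ≤ δ₁ * x ^ ((1 : ℝ) / 8) := by
    filter_upwards [(isLittleO_log_rpow_atTop (by norm_num : (0 : ℝ) < 1 / 8)).bound hδ₁0,
      eventually_gt_atTop (1 : ℝ)] with x hx hx1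
    rw [Real.norm_of_nonneg (Real.log_pos hx1).le,
      Real.norm_of_nonneg (Real.rpow_nonneg (by linarith) _)] at hx
    exact hx
  have hL2 : ∀ᶠ x : ℝ in atTop, Real.log x ^ 10 ≤ δ₂ * Real.sqrt x := by
    filter_upwards [(isLittleO_log_rpow_rpow_atTop ((10 : ℕ) : ℝ)
      (by norm_num : (0 : ℝ) < 1 / 2)).bound hδ₂0, eventually_gt_atTop (1 : ℝ)] with x hx hx1
    rw [Real.rpow_natCast, Real.norm_of_nonneg (pow_nonneg (Real.log_pos hx1).le _),
      Real.norm_of_nonneg (Real.rpow_nonneg (by linarith) _), ← Real.sqrt_eq_rpow] at hx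
    exact hx
  obtain ⟨N₀, hN₀⟩ := eventually_atTop.mp ((eventually_regime hc 6).and
    ((tendsto_hbX.eventually hL1).and (tendsto_hbX.eventually hL2)))
  refine ⟨N₀, fun N hN => ?_⟩
  obtain ⟨⟨hN6, hX6, hη0, -, hsqrt, hS2, -, -, hSide1⟩, hl1, hl2⟩ := hN₀ N hN
  refine ⟨hSide1, ?_⟩
  have hX1 : 1 < hbX N := by linarith
  have hX0 : 0 < hbX N := by linarith
  have hηX0 : 0 < hbEta c N * hbX N := by positivity
  -- `s = √(ηX)`, `u = √s`, `u⁸ ≥ X`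
  set s : ℝ := Real.sqrt (hbEta c N * hbX N) with hs
  have hs0 : 0 < s := Real.sqrt_pos.mpr hηX0
  have hs2 : s ^ 2 = hbEta c N * hbX N := Real.sq_sqrt hηX0.le
  set u : ℝ := Real.sqrt s with hu
  have hu0 : 0 < u := Real.sqrt_pos.mpr hs0
  have hu2 : u ^ 2 = s := Real.sq_sqrt hs0.le
  have hu8 : hbX N ≤ u ^ 8 := by
    calc hbX N = Real.sqrt (hbX N) ^ 2 := (Real.sq_sqrt hX0.le).symm
      _ ≤ (hbEta c N * hbX N) ^ 2 := pow_le_pow_left₀ (Real.sqrt_nonneg _) hsqrt 2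
      _ = u ^ 8 := by rw [← hs2, ← hu2]; ring
  have hXu : hbX N ^ ((1 : ℝ) / 8) ≤ u := by
    calc hbX N ^ ((1 : ℝ) / 8) ≤ (u ^ 8) ^ ((1 : ℝ) / 8) :=
          Real.rpow_le_rpow hX0.le hu8 (by norm_num)
      _ = u := by
          rw [show ((1 : ℝ) / 8) = ((8 : ℕ) : ℝ)⁻¹ by norm_num]
          exact Real.pow_rpow_inv_natCast hu0.le (by norm_num)
  -- the two growth conditions at this `N`
  have h1 : 32 * C * Real.log (hbX N) ≤ 3 * ε * u := by
    have h : Real.log (hbX N) ≤ δ₁ * u := hl1.trans (mul_le_mul_of_nonneg_left hXu hδ₁0.le)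
    calc 32 * C * Real.log (hbX N) ≤ 32 * C * (δ₁ * u) :=
          mul_le_mul_of_nonneg_left h (by positivity)
      _ = 3 * ε * u := by rw [hδ₁]; field_simp
  have h2 : 4 ^ 11 * K * Real.log (hbX N) ^ 10 ≤ 3 * ε * (hbEta c N * hbX N) := by
    have hl0 : 0 ≤ Real.log (hbX N) ^ 10 := pow_nonneg (Real.log_pos hX1).le _
    calc 4 ^ 11 * K * Real.log (hbX N) ^ 10 ≤ 4 ^ 11 * (K + 1) * Real.log (hbX N) ^ 10 := by
          gcongr; linarith
      _ ≤ 4 ^ 11 * (K + 1) * (δ₂ * Real.sqrt (hbX N)) :=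
          mul_le_mul_of_nonneg_left hl2 (by positivity)
      _ = 3 * ε * Real.sqrt (hbX N) := by rw [hδ₂]; field_simp
      _ ≤ 3 * ε * (hbEta c N * hbX N) := mul_le_mul_of_nonneg_left hsqrt (by positivity)
  -- the sum over the large moduli
  set G := (Icc 1 N).filter (fun d : ℕ =>
    Squarefree d ∧ Odd d ∧ Real.sqrt (hbEta c N * hbX N) < d) with hG
  set S : ℝ := (hbSide c N : ℝ) with hSdef
  have hS0 : 0 ≤ S := Nat.cast_nonneg _
  have hterm : ∀ d ∈ G, (∏ p ∈ d.primeFactors, (1 : ℝ) / ((p : ℝ) - 2)) *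
        (S * 3 ^ #d.primeFactors * (S / d + 1)) ≤
      S * (S * ∏ p ∈ d.primeFactors, (18 : ℝ) / (p : ℝ) ^ 2 +
        ∏ p ∈ d.primeFactors, (9 : ℝ) / (p : ℝ)) := by
    intro d hd
    rw [hG, mem_filter, mem_Icc] at hd
    obtain ⟨⟨hd1, -⟩, hsq, hodd, -⟩ := hd
    refine (singWeight_mul_lattice_le hsq hodd hd1 hS0).trans ?_
    have h18 : ∏ p ∈ d.primeFactors, (9 : ℝ) / (p : ℝ) ^ 2 ≤
        ∏ p ∈ d.primeFactors, (18 : ℝ) / (p : ℝ) ^ 2 :=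
      prod_le_prod (fun p _ => by positivity) fun p _ =>
        div_le_div_of_nonneg_right (by norm_num) (by positivity)
    exact mul_le_mul_of_nonneg_left
      (add_le_add (mul_le_mul_of_nonneg_left h18 hS0) le_rfl) hS0
  have hGP : ∀ d ∈ G, Squarefree d ∧ d.primeFactors ⊆ (Icc 1 N).filter Nat.Prime ∧ s < (d : ℝ) := by
    intro d hd
    rw [hG, mem_filter, mem_Icc] at hd
    obtain ⟨⟨-, hdN⟩, hsq, -, hsd⟩ := hd
    refine ⟨hsq, fun p hp => ?_, hsd⟩
    have hpp := Nat.prime_of_mem_primeFactors hp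
    rw [mem_filter, mem_Icc]
    exact ⟨⟨hpp.one_lt.le, (Nat.le_of_mem_primeFactors hp).trans hdN⟩, hpp⟩
  have hsum1 : ∑ d ∈ G, ∏ p ∈ d.primeFactors, (18 : ℝ) / (p : ℝ) ^ 2 ≤ C / u := by
    refine (sum_prod_primeFactors_le_tail _ (fun p _ => by positivity) hGP).trans ?_
    exact htail _ s hs0
  have hsum2 : ∑ d ∈ G, ∏ p ∈ d.primeFactors, (9 : ℝ) / (p : ℝ) ≤ K * Real.log N ^ 9 := by
    have h := sum_prod_nine_div_le (N := N) (by omega) G fun d hd => by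
      rw [hG, mem_filter] at hd
      exact ⟨hd.2.1, hd.1⟩
    calc ∑ d ∈ G, ∏ p ∈ d.primeFactors, (9 : ℝ) / (p : ℝ)
        ≤ (Real.exp 5 * Real.log N / Real.log 2) ^ 9 := h
      _ = K * Real.log N ^ 9 := by rw [hK]; ring
  have hsum : ∑ d ∈ G, (∏ p ∈ d.primeFactors, (1 : ℝ) / ((p : ℝ) - 2)) *
        (S * 3 ^ #d.primeFactors * (S / d + 1)) ≤ S * (S * (C / u) + K * Real.log N ^ 9) := by
    calc ∑ d ∈ G, (∏ p ∈ d.primeFactors, (1 : ℝ) / ((p : ℝ) - 2)) *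
          (S * 3 ^ #d.primeFactors * (S / d + 1))
        ≤ ∑ d ∈ G, S * (S * ∏ p ∈ d.primeFactors, (18 : ℝ) / (p : ℝ) ^ 2 +
            ∏ p ∈ d.primeFactors, (9 : ℝ) / (p : ℝ)) := sum_le_sum hterm
      _ = S * (S * ∑ d ∈ G, ∏ p ∈ d.primeFactors, (18 : ℝ) / (p : ℝ) ^ 2 +
            ∑ d ∈ G, ∏ p ∈ d.primeFactors, (9 : ℝ) / (p : ℝ)) := by
          simp only [mul_add, mul_sum, sum_add_distrib]
      _ ≤ S * (S * (C / u) + K * Real.log N ^ 9) := by gcongr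
  -- assemble
  have hA := rpow_third_le_two_mul_hbX N
  have hℓN := log_le_four_mul_log_hbX hX6
  have hfin := largeTail_arith hX0 hA (Real.log_natCast_nonneg N) hℓN hS0 hS2 hη0.le hu0 hC.le
    hK0 h1 h2
  rw [← cast_eq_six_mul_hbX_pow N] at hfin
  calc (N : ℝ) ^ ((1 : ℝ) / 3) * Real.log N *
        ∑ d ∈ G, (∏ p ∈ d.primeFactors, (1 : ℝ) / ((p : ℝ) - 2)) *
          (S * 3 ^ #d.primeFactors * (S / d + 1))
      ≤ (N : ℝ) ^ ((1 : ℝ) / 3) * Real.log N * (S * (S * (C / u) + K * Real.log N ^ 9)) :=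
        mul_le_mul_of_nonneg_left hsum (mul_nonneg (by positivity) (Real.log_natCast_nonneg N))
    _ ≤ ε * (hbEta c N ^ 2 * N) := hfin

/-! ### (C) composition -/

/-- **`LargeModuliCorrelation` holds** (route `RomanoffHeathBrown`, crux stmt-Parity-20273): for every
`c > 0` and `ε > 0` there is `N₀` with `∑_{√(ηX) < d ≤ N, d odd sqf} g(d) ∑_{r<d} U_d(r)² ≤ ε · η²N · U`
for `N ≥ N₀`.  Composition of (A) `classSum_le_lattice`, (B) `largeModuli_sum_le` and the
ℓ²-to-sup step `classEnergy_le`. -/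
theorem romanoffHeathBrown_largeModuliCorrelation_proof :
    Summit.Parity.GeneralizedHardyLittlewood.Theses.RomanoffHeathBrown.LargeModuliCorrelation := by
  intro c hc ε hε
  obtain ⟨N₀, hN₀⟩ := largeModuli_sum_le hc hε
  refine ⟨N₀, fun N hN => ?_⟩
  obtain ⟨hS1, hmain⟩ := hN₀ N hN
  set U : ℝ := ∑ k ∈ Icc 1 N, hbWeight c N k with hU
  have hU0 : 0 ≤ U := sum_nonneg fun k _ => hbWeight_nonneg c N k
  set G := (Icc 1 N).filter (fun d : ℕ =>
    Squarefree d ∧ Odd d ∧ Real.sqrt (hbEta c N * hbX N) < d) with hG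
  have hterm : ∀ d ∈ G,
      (∏ p ∈ d.primeFactors, (1 : ℝ) / ((p : ℝ) - 2)) *
          ∑ r ∈ range d, (∑ k ∈ (Icc 1 N).filter (fun k : ℕ => k ≡ r [MOD d]), hbWeight c N k) ^ 2 ≤
        (∏ p ∈ d.primeFactors, (1 : ℝ) / ((p : ℝ) - 2)) *
          ((N : ℝ) ^ ((1 : ℝ) / 3) * Real.log N *
            ((hbSide c N : ℝ) * 3 ^ #d.primeFactors * ((hbSide c N : ℝ) / d + 1)) * U) := by
    intro d hd
    rw [hG, mem_filter, mem_Icc] at hd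
    obtain ⟨⟨hd1, -⟩, hsq, hodd, -⟩ := hd
    refine mul_le_mul_of_nonneg_left ?_ (prod_primeFactors_inv_sub_two_nonneg hodd)
    exact classEnergy_le c N hd1 fun r _ => classSum_le_lattice c N hS1 hsq r
  calc ∑ d ∈ G, (∏ p ∈ d.primeFactors, (1 : ℝ) / ((p : ℝ) - 2)) *
          ∑ r ∈ range d, (∑ k ∈ (Icc 1 N).filter (fun k : ℕ => k ≡ r [MOD d]), hbWeight c N k) ^ 2
      ≤ ∑ d ∈ G, (∏ p ∈ d.primeFactors, (1 : ℝ) / ((p : ℝ) - 2)) *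
          ((N : ℝ) ^ ((1 : ℝ) / 3) * Real.log N *
            ((hbSide c N : ℝ) * 3 ^ #d.primeFactors * ((hbSide c N : ℝ) / d + 1)) * U) :=
        sum_le_sum hterm
    _ = ∑ d ∈ G, (N : ℝ) ^ ((1 : ℝ) / 3) * Real.log N *
          ((∏ p ∈ d.primeFactors, (1 : ℝ) / ((p : ℝ) - 2)) *
            ((hbSide c N : ℝ) * 3 ^ #d.primeFactors * ((hbSide c N : ℝ) / d + 1))) * U :=
        sum_congr rfl fun d _ => by ring
    _ = (N : ℝ) ^ ((1 : ℝ) / 3) * Real.log N *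
          (∑ d ∈ G, (∏ p ∈ d.primeFactors, (1 : ℝ) / ((p : ℝ) - 2)) *
            ((hbSide c N : ℝ) * 3 ^ #d.primeFactors * ((hbSide c N : ℝ) / d + 1))) * U := by
        rw [← sum_mul, ← mul_sum]
    _ ≤ ε * (hbEta c N ^ 2 * N) * U := mul_le_mul_of_nonneg_right hmain hU0

end Summit.Parity.GeneralizedHardyLittlewood.Theorems.RomanoffHeathBrown

end
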